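import Mathlib
import HarnessLib
import Summits.HubbardSuperconductivity.HubbardSuperconductivity.Theorems.KLProgrammeH10TwoPointLimitSectorMultiplierJump
import Summits.HubbardSuperconductivity.HubbardSuperconductivity.Theorems.KLProgrammeH10TwoPointLimitSectorMultiplierOverlapRegime
import Summits.HubbardSuperconductivity.HubbardSuperconductivity.Theorems.KLProgrammeKLRegimeEngineV8DefsU9

/-!
# Route `KLProgramme` — engine support, route (L2): the overlap constants `cr`, `c₁`, `c₁r` of `E(klAnisoFamily J′)·S(F̃_k)` at EVERY jump
# `k + 1 ≤ J′ ≤ n_β + 1` IN THE KL REGIME, keyed by `FrameOK` and by the binders of `stub_engine_step_norms` — ONE absolute constant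

Cell gate-hubbard-kl, seat hubbard-kl-k3c2-p3 (g6).  `…SectorMultiplierJump` turns a UNIFORM neighbouring-scale bound `T` on the thin × thin
character sums into the three overlap constants at any jump (`overlap_jump_sums_le_of_neighbouring`, Young route); p4's `…SectorMultiplierOverlap`
/ `…OverlapRegime` produce that neighbouring bound on an admissible frame and discharge every threshold in the KL regime.  This file composes:

* `charSum_klAnisoPair_nb_le_frameKeyed` — the frame-keyed thin × thin bound at the scales `(n, n−1)`, `T = C_B·M·L²` with p4's constant
  `C_B = √(2048(π√c_G+1)κ_X·(160/π)c_{N,1}c_{N,2}/e₀)` (the `T`-level statement inside p4's `overlap_sums_klAniso_bgmFat_le`, exposed);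
* `charSum_klAnisoPair_nb_of_thresholds` — in the KL regime (`klBetaMin ≤ β ≤ e^{c/U²}`, `μ ∈ klWindowC`, `FrameOK`, `β² ≤ L`, `β ≤ M`, absolute
  thresholds on `c`, `U`): `∃ C_T > 0`, for all `1 ≤ n ≤ n_β + 1` and all sectors the neighbouring character sum is `≤ C_T·M·L²`;
* **`overlap_jump_sums_of_thresholds`** / **`overlap_jump_sums_klEng`** — `∃ C_J > 0` such that, under the absolute thresholds / under EXACTLY the
  binders of the registered stub `stub_engine_step_norms` of item stmt-HubbardSuperconductivity-20437 (`P.WF`, `R.WF2`, `0 < c ≤ klEngC₃6 P R`,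
  `μ ∈ klWindowC`, `0 < U ≤ klEngU₀9 P R c`, `klBetaMin ≤ β ≤ e^{c/U²}`, `FrameOK R U (nScales β) μ K`, `klEngL₃ β U ≤ L`, `klEngM₃ β U L ≤ M`),
  for EVERY jump `k + 1 ≤ J′ ≤ nScales β + 1`: row sums `≤ 81·C_J·M/β`, per-pair fine-position sums `≤ 3·C_J·M/β`, per-pair coarse-position sums
  `≤ 3·C_J·M/β` — i.e. with `ε_x = β/(2M)`: `ε_x·cr ≤ 81C_J/2`, `ε_x·c₁, ε_x·c₁r ≤ 3C_J/2`, n-, jump-, β-, L-, M-, frame-UNIFORM — the `hrow′`, `hcol₁`,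
  `hrow₁` inputs of `EngineV8.hubbardSectorKernelNorm_klAniso_jump_le_of_relCount(_split)`, `EngineV8.hubbardSectorPinnedSum_klAniso_jump_le`,
  `EngineV8.hubbardSectorPrescribedSum_klAniso_jump_le_split` (`C_J = C_T + 729·C_T²/2`).

Everything is proved; no definitions; nothing about the model is asserted beyond these implications.
[cite: BenfattoGiulianiMastropietro2006, §2.7 (2.71a), §2.8 (2.77), (2.82)-(2.83)]
-/

noncomputable section

namespace Summit.HubbardSuperconductivity.HubbardSuperconductivity.Theorems.TorusFourierL2

set_option linter.dupNamespace false -- summit = problem name (single-conjunct summit), D-0017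

open Set Finset Literature.MathematicalPhysics.QuantumLattice Literature.MathematicalPhysics.QuantumLattice.BandSectorCounting
open Literature.MathematicalPhysics.QuantumLattice.FermiRG Literature.Probability.LatticeModels Literature.Analysis.SpecialFunctions
open Summit.HubbardSuperconductivity.HubbardSuperconductivity.Theorems.DispersionFlow
open Summit.HubbardSuperconductivity.HubbardSuperconductivity.Theorems.KLRegimeSplit
open Summit.HubbardSuperconductivity.HubbardSuperconductivity.Theorems.KLProgrammeLegKernels
open Summit.HubbardSuperconductivity.HubbardSuperconductivity.Theorems.PerturbedFermiCurve
open scoped Real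

/-! ### §1 Frame-keyed: the neighbouring thin × thin bound, exposed -/

section FrameKeyed

variable {L M : ℕ} [NeZero L] [NeZero M] {a b : ℝ} (B : BandBounds a b) {K : TrigPolyC4v} {A : ℝ}
  (hA : ∀ p : Momentum, ∀ j ≤ 2, ‖iteratedFDeriv ℝ j (frameShift K) p‖ ≤ A) (hADt : 2 * A < B.Dtmin)
  {μ e₀ z β : ℝ} (he : 0 < e₀) (hz : 0 < z) (hz1 : z ≤ 1) (hgap : e₀ + A + z ^ 2 < -μ) (h3 : e₀ + A - μ ≤ 3)
  (hlo : a ≤ μ - A - e₀) (hhi : μ + A + e₀ ≤ b) (hβ : 0 < β) (hρA : 4 * A < 2 * B.rhomin)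
  {d : ℝ} (hd : 0 < d) (hd1 : ∀ u, |deriv (bgmCutoffSq e₀) u| ≤ d) (hd2 : ∀ u, |iteratedDeriv 2 (bgmCutoffSq e₀) u| ≤ d)
  {Ba : ℝ} (hB0 : 0 < Ba)
  (hB : ∀ (i : ℕ), i ≤ 2 → ∀ (n : ℕ) (ω : ℤ) (θ₀ : ℝ) (q w : Fin 2 → ℝ) (t : ℝ) {r₀ : ℝ}, 0 < r₀ →
    r₀ ≤ ‖momToComplex (q + t • w)‖ → |sectorRelAngle θ₀ (q + t • w)| < π →
    ‖iteratedDeriv i (fun t : ℝ => sectorWeightCirc n ω (polarAngle (q + t • w))) t‖ ≤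
      (2 : ℕ).factorial * Ba * ((1 + (sectorWidth n)⁻¹ * (2 : ℕ).factorial) * ‖momToComplex w‖ / r₀) ^ i)
  {cG c1 ρb Y κ κX cN1 cN2 : ℝ}
  (hcG : cG = 4 * (d * e₀ ^ 4 * 1 + 2 * (d * e₀ ^ 2) * (d * e₀ ^ 2) + 1 * (d * e₀ ^ 4)) + 2 * (d * e₀ ^ 2 * 1 + 1 * (d * e₀ ^ 2)))
  (hc1 : c1 = d * e₀ ^ 2 * 1 + 1 * (d * e₀ ^ 2))
  (hρb : ρb = (e₀ + 3 * π / 2 * B.smax * B.Dtmin) / (B.Dtmin - 2 * A))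
  (hY : Y = (4 + 2 * A) + (4 + 4 * A) * (2 * ρb + 5))
  (hκ : κ = cG * Y ^ 2 + 2 * c1 * (4 + 4 * A) * (9 / 4) * e₀ + 8 * c1 * Ba * Y * 12 * e₀ + 2 * Ba * 72 * e₀ ^ 2 +
    8 * Ba ^ 2 * 36 * e₀ ^ 2)
  (hκX : κX = 4 * (3 * Real.sqrt 2 * π * Real.sqrt κ + 2 * e₀) ^ 2 / e₀ +
    96 / (π * e₀ ^ 2) * ((π * Real.sqrt κ / 2) * (π * Real.sqrt κ / 2 + e₀) ^ 2))
  (hcN1 : cN1 = Real.sqrt 2 * (e₀ + (4 + 4 * A) * ρb ^ 2) / ((2 * B.rhomin - 4 * A) * π) + 2)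
  (hcN2 : cN2 = 2 * Real.sqrt 2 * ρb / π + 2)

include B hA hADt he hz hz1 hgap h3 hlo hhi hβ hρA hd hd1 hd2 hB0 hB hcG hc1 hρb hY hκ hκX hcN1 hcN2 in
/-- **The neighbouring thin × thin character-sum bound on an admissible frame, exposed**: for `1 ≤ n` and the scale thresholds of
`charSum_klAnisoPair_le_uniform`, every product `F_{n,ω₁}·F_{n−1,a′}` of `klAnisoFamily` multipliers has space-time character sum of `ℓ¹` norm
`≤ C_B·M·L²` (p4's composition inside `overlap_sums_klAniso_bgmFat_le`, stated on its own). [cite: BenfattoGiulianiMastropietro2006, §2.7 (2.71a)] -/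
theorem charSum_klAnisoPair_nb_le_frameKeyed {n : ℕ} (hn : 1 ≤ n) (hM : klScale e₀ n * β < π * (2 * M - 3)) (hMβ : β * e₀ ≤ M)
    (hLz : 2 * |2 * π / (L : ℝ)| * ((2 : ℝ) ^ n + 1 / 2) ≤ z) (hL16 : 2 * π * (16 : ℝ) ^ n ≤ L) (hΛβ : π / (4 * β) ≤ klScale e₀ n)
    (ω₁ : Fin (sectorCount n)) (a' : Fin (sectorCount (n - 1))) :
    ∑ zz : TorusSite 1 (2 * M) × TorusSite 2 L,
      ‖∑ q : TorusSite 1 (2 * M) × TorusSite 2 L, (torusChar q.1 zz.1 * torusChar q.2 zz.2) •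
        (klAnisoFamily L M β μ K e₀ n ω₁ (⟨(q.1 0).val, ZMod.val_lt (q.1 0)⟩, q.2) *
          klAnisoFamily L M β μ K e₀ (n - 1) a' (⟨(q.1 0).val, ZMod.val_lt (q.1 0)⟩, q.2))‖ ≤
      Real.sqrt (2048 * (π * Real.sqrt cG + 1) * κX * (160 / π * (cN1 * cN2)) / e₀) * M * (L : ℝ) ^ 2 :=
  charSum_klAnisoPair_le_uniform B hA hADt he hz hz1 hgap h3 hlo hhi hβ hρA (Nat.sub_le n 1) ω₁ a' hd hd1 hd2
    (Z := fun p : Fin 2 → ℝ => gnCutoff ((π + z) ^ 2 / π ^ 2) ((π + z) ^ 2) (p 0 ^ 2) *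
      gnCutoff ((π + z) ^ 2 / π ^ 2) ((π + z) ^ 2) (p 1 ^ 2) *
      ((radialCutoffC (1 / 2) (momToComplex p) * sectorWeightCirc n ((ω₁ : ℕ) : ℤ) (polarAngle p)) *
        (radialCutoffC (1 / 2) (momToComplex p) * sectorWeightCirc (n - 1) ((a' : ℕ) : ℤ) (polarAngle p))))
    (fun _ => rfl)
    (Φ := fun kp : ℝ × (Fin 2 → ℝ) => ((bgmCutoffSq e₀ ((16 : ℝ) ^ n * (kp.1 ^ 2 + frameLevel μ K (WithLp.toLp 2 kp.2) ^ 2)) *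
      bgmCutoffSq e₀ ((16 : ℝ) ^ (n - 1) * (kp.1 ^ 2 + frameLevel μ K (WithLp.toLp 2 kp.2) ^ 2)) *
      (gnCutoff ((π + z) ^ 2 / π ^ 2) ((π + z) ^ 2) (kp.2 0 ^ 2) * gnCutoff ((π + z) ^ 2 / π ^ 2) ((π + z) ^ 2) (kp.2 1 ^ 2) *
        ((radialCutoffC (1 / 2) (momToComplex kp.2) * sectorWeightCirc n ((ω₁ : ℕ) : ℤ) (polarAngle kp.2)) *
          (radialCutoffC (1 / 2) (momToComplex kp.2) * sectorWeightCirc (n - 1) ((a' : ℕ) : ℤ) (polarAngle kp.2)))) : ℝ) : ℂ))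
    (fun _ _ => rfl)
    (Gs := fun q : TorusSite 1 (2 * M) × TorusSite 2 L =>
      klAnisoFamily L M β μ K e₀ n ω₁ (⟨(q.1 0).val, ZMod.val_lt (q.1 0)⟩, q.2) *
        klAnisoFamily L M β μ K e₀ (n - 1) a' (⟨(q.1 0).val, ZMod.val_lt (q.1 0)⟩, q.2))
    (fun _ => rfl) hB0 hB hcG hc1 hρb hY hκ hκX hcN1 hcN2 (by omega) hM hMβ hLz hL16 hΛβ

end FrameKeyed

/-! ### §2 The KL regime: the neighbouring bound with ONE absolute constant -/

/-- **The neighbouring thin × thin bound in the KL regime** (absolute thresholds exposed, `B = bandBounds (−6/5) (−1/10)`,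
`κ₀ = min (min (Dt_min/4) (ρ_min/4)) (1/40)`): `∃ C_T > 0` such that for every `R` (`Gfr ≥ 0`), `0 < c ≤ κ₀/(12(Gfr₂+1))`,
`0 < U ≤ min 1 (κ₀/(24(Gfr₀+Gfr₁+1)))`, `klBetaMin ≤ β ≤ e^{c/U²}`, `μ ∈ klWindowC`, `FrameOK R U (nScales β) μ K`, `β² ≤ L`, `β ≤ M`, every scale
`1 ≤ n ≤ nScales β + 1` and all sectors: the character sum of `F_{n,ω}·F_{n−1,a}` (`e₀ = klE0`) has `ℓ¹` norm `≤ C_T·M·L²`.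
[cite: BenfattoGiulianiMastropietro2006, §2.7 (2.71a)] -/
theorem charSum_klAnisoPair_nb_of_thresholds (ha : (-4 : ℝ) < -(6 / 5)) (hab : (-(6 / 5) : ℝ) ≤ -(1 / 10))
    (hb : (-(1 / 10) : ℝ) < 0) :
    ∃ CT : ℝ, 0 < CT ∧ ∀ (R : RenConsts), (∀ j, 0 ≤ R.Gfr j) →
      ∀ (c U : ℝ), 0 < c →
      c ≤ min (min ((bandBounds ha hab hb).Dtmin / 4) ((bandBounds ha hab hb).rhomin / 4)) (1 / 40) / (12 * (R.Gfr 2 + 1)) → 0 < U →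
      U ≤ min 1 (min (min ((bandBounds ha hab hb).Dtmin / 4) ((bandBounds ha hab hb).rhomin / 4)) (1 / 40) / (24 * (R.Gfr 0 + R.Gfr 1 + 1))) →
      ∀ β : ℝ, klBetaMin ≤ β → β ≤ Real.exp (c / U ^ 2) → ∀ μ ∈ klWindowC, ∀ K : TrigPolyC4v, FrameOK R U (nScales β) μ K →
      ∀ (L M : ℕ) [NeZero L] [NeZero M], β ^ 2 ≤ (L : ℝ) → β ≤ (M : ℝ) → ∀ n : ℕ, 1 ≤ n → n ≤ nScales β + 1 →
        ∀ (ω : Fin (sectorCount n)) (a' : Fin (sectorCount (n - 1))),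
          ∑ zz : TorusSite 1 (2 * M) × TorusSite 2 L,
            ‖∑ q : TorusSite 1 (2 * M) × TorusSite 2 L, (torusChar q.1 zz.1 * torusChar q.2 zz.2) •
              (klAnisoFamily L M β μ K klE0 n ω (⟨(q.1 0).val, ZMod.val_lt (q.1 0)⟩, q.2) *
                klAnisoFamily L M β μ K klE0 (n - 1) a' (⟨(q.1 0).val, ZMod.val_lt (q.1 0)⟩, q.2))‖ ≤ CT * M * (L : ℝ) ^ 2 := by
  -- the window band bounds and the absolute frame-size threshold
  set B : BandBounds (-(6 / 5)) (-(1 / 10)) := bandBounds ha hab hb with hBdef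
  set κ₀ : ℝ := min (min (B.Dtmin / 4) (B.rhomin / 4)) (1 / 40) with hκ₀
  have hDt := B.Dtmin_pos
  have hrh := B.rhomin_pos
  have hκ₀pos : 0 < κ₀ := by rw [hκ₀]; exact lt_min (lt_min (by positivity) (by positivity)) (by norm_num)
  have hκ₀Dt : κ₀ ≤ B.Dtmin / 4 := (min_le_left _ _).trans (min_le_left _ _)
  have hκ₀rh : κ₀ ≤ B.rhomin / 4 := (min_le_left _ _).trans (min_le_right _ _)
  have hκ₀40 : κ₀ ≤ 1 / 40 := min_le_right _ _
  -- the cutoff constants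
  have he : (0 : ℝ) < klE0 := by norm_num [klE0]
  obtain ⟨d₀, hd₀, hd₀1, hd₀2⟩ := exists_abs_derivs_bgmCutoffSq_le he
  obtain ⟨B₀, hB₀0, hB₀⟩ := exists_norm_iteratedDeriv_sectorWeightCirc_polarAngle_line_le 2
  have hd : (0 : ℝ) < d₀ + 1 := by linarith
  have hd1 : ∀ u, |deriv (bgmCutoffSq klE0) u| ≤ d₀ + 1 := fun u => (hd₀1 u).trans (by linarith)
  have hd2 : ∀ u, |iteratedDeriv 2 (bgmCutoffSq klE0) u| ≤ d₀ + 1 := fun u => (hd₀2 u).trans (by linarith)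
  have hBa : (0 : ℝ) < B₀ + 1 := by linarith
  have hB : ∀ (i : ℕ), i ≤ 2 → ∀ (n : ℕ) (ω : ℤ) (θ₀ : ℝ) (q w : Fin 2 → ℝ) (t : ℝ) {r₀ : ℝ}, 0 < r₀ →
      r₀ ≤ ‖momToComplex (q + t • w)‖ → |sectorRelAngle θ₀ (q + t • w)| < π →
      ‖iteratedDeriv i (fun t : ℝ => sectorWeightCirc n ω (polarAngle (q + t • w))) t‖ ≤
        (2 : ℕ).factorial * (B₀ + 1) * ((1 + (sectorWidth n)⁻¹ * (2 : ℕ).factorial) * ‖momToComplex w‖ / r₀) ^ i := by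
    intro i hi n ω θ₀ q w t r₀ hr₀ hr hθ
    refine (hB₀ i hi n ω θ₀ q w t hr₀ hr hθ).trans ?_
    have hX : 0 ≤ ((1 + (sectorWidth n)⁻¹ * (2 : ℕ).factorial) * ‖momToComplex w‖ / r₀) ^ i := by
      have := sectorWidth_pos n; positivity
    have h2 : (0 : ℝ) ≤ (2 : ℕ).factorial := Nat.cast_nonneg _
    nlinarith [mul_nonneg h2 hX]
  -- the absolute constant
  set A : ℝ := κ₀ / 4 with hAdef
  have hA0 : 0 < A := by rw [hAdef]; positivity
  have hDtA : 0 < B.Dtmin - 2 * A := by rw [hAdef]; linarith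
  have hrhA : 0 < 2 * B.rhomin - 4 * A := by rw [hAdef]; linarith
  have hsm := B.smax_pos
  have hπ := Real.pi_pos
  obtain ⟨ρb, hρb⟩ : ∃ ρb : ℝ, ρb = (klE0 + 3 * π / 2 * B.smax * B.Dtmin) / (B.Dtmin - 2 * A) := ⟨_, rfl⟩
  obtain ⟨cG, hcG⟩ : ∃ cG : ℝ, cG = 4 * ((d₀ + 1) * klE0 ^ 4 * 1 + 2 * ((d₀ + 1) * klE0 ^ 2) * ((d₀ + 1) * klE0 ^ 2) +
      1 * ((d₀ + 1) * klE0 ^ 4)) + 2 * ((d₀ + 1) * klE0 ^ 2 * 1 + 1 * ((d₀ + 1) * klE0 ^ 2)) := ⟨_, rfl⟩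
  obtain ⟨c1, hc1⟩ : ∃ c1 : ℝ, c1 = (d₀ + 1) * klE0 ^ 2 * 1 + 1 * ((d₀ + 1) * klE0 ^ 2) := ⟨_, rfl⟩
  obtain ⟨Y, hY⟩ : ∃ Y : ℝ, Y = (4 + 2 * A) + (4 + 4 * A) * (2 * ρb + 5) := ⟨_, rfl⟩
  obtain ⟨κ, hκ⟩ : ∃ κ : ℝ, κ = cG * Y ^ 2 + 2 * c1 * (4 + 4 * A) * (9 / 4) * klE0 + 8 * c1 * (B₀ + 1) * Y * 12 * klE0 +
      2 * (B₀ + 1) * 72 * klE0 ^ 2 + 8 * (B₀ + 1) ^ 2 * 36 * klE0 ^ 2 := ⟨_, rfl⟩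
  obtain ⟨κX, hκX⟩ : ∃ κX : ℝ, κX = 4 * (3 * Real.sqrt 2 * π * Real.sqrt κ + 2 * klE0) ^ 2 / klE0 +
      96 / (π * klE0 ^ 2) * ((π * Real.sqrt κ / 2) * (π * Real.sqrt κ / 2 + klE0) ^ 2) := ⟨_, rfl⟩
  obtain ⟨cN1, hcN1⟩ : ∃ cN1 : ℝ, cN1 = Real.sqrt 2 * (klE0 + (4 + 4 * A) * ρb ^ 2) / ((2 * B.rhomin - 4 * A) * π) + 2 := ⟨_, rfl⟩
  obtain ⟨cN2, hcN2⟩ : ∃ cN2 : ℝ, cN2 = 2 * Real.sqrt 2 * ρb / π + 2 := ⟨_, rfl⟩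
  have hρb0 : 0 ≤ ρb := by rw [hρb]; positivity
  have hcG0 : 0 < cG := by rw [hcG]; positivity
  have hκX0 : 0 < κX := by rw [hκX]; positivity
  have hcN10 : 0 < cN1 := by rw [hcN1]; positivity
  have hcN20 : 0 < cN2 := by rw [hcN2]; positivity
  have hS0 : 0 < Real.sqrt (2048 * (π * Real.sqrt cG + 1) * κX * (160 / π * (cN1 * cN2)) / klE0) :=
    Real.sqrt_pos.2 (by positivity)
  refine ⟨Real.sqrt (2048 * (π * Real.sqrt cG + 1) * κX * (160 / π * (cN1 * cN2)) / klE0), hS0, ?_⟩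
  intro R hR c U hc hcle hU hUle β hβmin hβc μ hμ K hK L M _ _ hLβ hMβ n hn hnN ω a'
  have hβ0 : 0 < β := pos_of_klBetaMin_le hβmin
  -- the frame's `C²` size is `≤ A = κ₀/4`
  have hlog : 1 ≤ Real.log 4 := by
    have h4 : Real.exp 1 ≤ 4 := by have := Real.exp_one_lt_d9; norm_num at this; linarith
    calc (1 : ℝ) = Real.log (Real.exp 1) := (Real.log_exp 1).symm
      _ ≤ Real.log 4 := Real.log_le_log (Real.exp_pos 1) h4
  have hAK : ∀ p : Momentum, ∀ j ≤ 2, ‖iteratedFDeriv ℝ j (frameShift K) p‖ ≤ A := by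
    intro p j hj
    refine (norm_iteratedFDeriv_frameShift_le_of_frameOK_regime hR hc.le hβmin hβc hK p hj).trans ?_
    have h0 := hR 0; have h1 := hR 1; have h2 := hR 2
    have hU1 : U ≤ 1 := hUle.trans (min_le_left _ _)
    have hUk : U ≤ κ₀ / (24 * (R.Gfr 0 + R.Gfr 1 + 1)) := hUle.trans (min_le_right _ _)
    rw [abs_of_pos hU]
    have hU2 : U ^ 2 ≤ U := by nlinarith only [hU, hU1]
    have hA1 : 2 * R.Gfr 0 * U + 2 * R.Gfr 1 * U ^ 2 ≤ 2 * (R.Gfr 0 + R.Gfr 1 + 1) * U := by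
      have := mul_le_mul_of_nonneg_left hU2 h1
      linarith only [this, hU.le]
    have hB1 : 2 * (R.Gfr 0 + R.Gfr 1 + 1) * U ≤ κ₀ / 12 := by
      have hpos : 0 < 24 * (R.Gfr 0 + R.Gfr 1 + 1) := by positivity
      have := (le_div_iff₀ hpos).mp hUk
      linarith only [this]
    have hC1 : R.Gfr 2 * (c / Real.log 4) ≤ R.Gfr 2 * c := mul_le_mul_of_nonneg_left (div_le_self hc.le hlog) h2
    have hD1 : R.Gfr 2 * c ≤ κ₀ / 12 := by
      have hpos : 0 < 12 * (R.Gfr 2 + 1) := by positivity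
      have := (le_div_iff₀ hpos).mp hcle
      linarith only [this, hc.le]
    rw [hAdef]; linarith only [hA1, hB1, hC1, hD1, hκ₀pos]
  -- the window margins
  have hμ' := hμ
  simp only [klWindowC, Set.mem_Icc] at hμ'
  have e1 : (-1.05 : ℝ) = -(21 / 20) := by norm_num
  have e2 : (-0.15 : ℝ) = -(3 / 20) := by norm_num
  have hμlo : -(21 / 20 : ℝ) ≤ μ := by rw [← e1]; exact hμ'.1
  have hμhi : μ ≤ -(3 / 20 : ℝ) := by rw [← e2]; exact hμ'.2
  have he0 : klE0 = 1 / 32 := rfl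
  have hgap : klE0 + A + (1 / 10 : ℝ) ^ 2 < -μ := by rw [he0, hAdef]; linarith only [hμhi, hκ₀40]
  have h3 : klE0 + A - μ ≤ 3 := by rw [he0, hAdef]; linarith only [hμlo, hκ₀40]
  have hlo : (-(6 / 5) : ℝ) ≤ μ - A - klE0 := by rw [he0, hAdef]; linarith only [hμlo, hκ₀40]
  have hhi : μ + A + klE0 ≤ -(1 / 10) := by rw [he0, hAdef]; linarith only [hμhi, hκ₀40]
  have hADt : 2 * A < B.Dtmin := by rw [hAdef]; linarith
  have hρA : 4 * A < 2 * B.rhomin := by rw [hAdef]; linarith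
  -- the scale thresholds
  obtain ⟨hM, hMβ', hLz, hL16, hΛβ⟩ := regime_scale_thresholds hβmin hLβ hMβ hnN
  exact charSum_klAnisoPair_nb_le_frameKeyed (L := L) (M := M) (μ := μ) (K := K) B hAK hADt he (by norm_num : (0 : ℝ) < 1 / 10)
    (by norm_num : (1 / 10 : ℝ) ≤ 1) hgap h3 hlo hhi hβ0 hρA hd hd1 hd2 hBa hB hcG hc1 hρb hY hκ hκX hcN1 hcN2 hn hM hMβ' hLz hL16 hΛβ ω a'

/-! ### §3 The jump constants in the KL regime -/

/-- **The overlap constants at every jump, absolute thresholds**: `∃ C_J > 0` with, under the hypotheses of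
`charSum_klAnisoPair_nb_of_thresholds`, for all `k + 1 ≤ J′ ≤ nScales β + 1`: row sums of `‖E(klAnisoFamily J′)·S(F̃_k)‖` `≤ 81·C_J·M/β`,
per-pair fine-position sums `≤ 3·C_J·M/β`, per-pair coarse-position sums `≤ 3·C_J·M/β`.
[cite: BenfattoGiulianiMastropietro2006, §2.7 (2.71a), §2.8 (2.77)] -/
theorem overlap_jump_sums_of_thresholds (ha : (-4 : ℝ) < -(6 / 5)) (hab : (-(6 / 5) : ℝ) ≤ -(1 / 10))
    (hb : (-(1 / 10) : ℝ) < 0) :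
    ∃ CJ : ℝ, 0 < CJ ∧ ∀ (R : RenConsts), (∀ j, 0 ≤ R.Gfr j) →
      ∀ (c U : ℝ), 0 < c →
      c ≤ min (min ((bandBounds ha hab hb).Dtmin / 4) ((bandBounds ha hab hb).rhomin / 4)) (1 / 40) / (12 * (R.Gfr 2 + 1)) → 0 < U →
      U ≤ min 1 (min (min ((bandBounds ha hab hb).Dtmin / 4) ((bandBounds ha hab hb).rhomin / 4)) (1 / 40) / (24 * (R.Gfr 0 + R.Gfr 1 + 1))) →
      ∀ β : ℝ, klBetaMin ≤ β → β ≤ Real.exp (c / U ^ 2) → ∀ μ ∈ klWindowC, ∀ K : TrigPolyC4v, FrameOK R U (nScales β) μ K →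
      ∀ (L M : ℕ) [NeZero L] [NeZero M], β ^ 2 ≤ (L : ℝ) → β ≤ (M : ℝ) → ∀ k J' : ℕ, k + 1 ≤ J' → J' ≤ nScales β + 1 →
        (∀ X'' : SpaceTimeIdx L M × SectorLeg (sectorCount J'),
          ∑ X', ‖(sectorAnalysisMatrix L M β (klAnisoFamily L M β μ K klE0 J') *
            sectorSubMatrix L M β (bgmFatMultiplier L M klE0 β (nambuXiCT L μ K) k)) X'' X'‖ ≤ 81 * CJ * M / β) ∧
        (∀ (ω'' : Fin (sectorCount J')) (ω' : Fin (sectorCount k)) (σ c : Fin 2) (x' : SpaceTimeIdx L M),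
          ∑ x'' : SpaceTimeIdx L M, ‖(sectorAnalysisMatrix L M β (klAnisoFamily L M β μ K klE0 J') *
            sectorSubMatrix L M β (bgmFatMultiplier L M klE0 β (nambuXiCT L μ K) k)) (x'', ((ω'', σ), c)) (x', ((ω', σ), c))‖ ≤
            3 * CJ * M / β) ∧
        (∀ (ω'' : Fin (sectorCount J')) (ω' : Fin (sectorCount k)) (σ c : Fin 2) (x'' : SpaceTimeIdx L M),
          ∑ x' : SpaceTimeIdx L M, ‖(sectorAnalysisMatrix L M β (klAnisoFamily L M β μ K klE0 J') *
            sectorSubMatrix L M β (bgmFatMultiplier L M klE0 β (nambuXiCT L μ K) k)) (x'', ((ω'', σ), c)) (x', ((ω', σ), c))‖ ≤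
            3 * CJ * M / β) := by
  obtain ⟨CT, hCT, h⟩ := charSum_klAnisoPair_nb_of_thresholds ha hab hb
  refine ⟨CT + 729 * CT ^ 2 / 2, by positivity, ?_⟩
  intro R hR c U hc hcle hU hUle β hβmin hβc μ hμ K hK L M _ _ hLβ hMβ k J' hJ hJN
  have hβ0 : 0 < β := pos_of_klBetaMin_le hβmin
  have hL0 : (0 : ℝ) < L := Nat.cast_pos.2 (Nat.pos_of_ne_zero (NeZero.ne L))
  have hM0 : (0 : ℝ) < M := Nat.cast_pos.2 (Nat.pos_of_ne_zero (NeZero.ne M))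
  have hT0 : 0 ≤ CT * M * (L : ℝ) ^ 2 := by positivity
  have hnb : ∀ n : ℕ, 1 ≤ n → n ≤ nScales β + 1 → ∀ (ω : Fin (sectorCount n)) (a' : Fin (sectorCount (n - 1))),
      ∑ zz : TorusSite 1 (2 * M) × TorusSite 2 L,
        ‖∑ q : TorusSite 1 (2 * M) × TorusSite 2 L, (torusChar q.1 zz.1 * torusChar q.2 zz.2) •
          (klAnisoFamily L M β μ K klE0 n ω (⟨(q.1 0).val, ZMod.val_lt (q.1 0)⟩, q.2) *
            klAnisoFamily L M β μ K klE0 (n - 1) a' (⟨(q.1 0).val, ZMod.val_lt (q.1 0)⟩, q.2))‖ ≤ CT * M * (L : ℝ) ^ 2 :=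
    fun n hn hnN ω a' => h R hR c U hc hcle hU hUle β hβmin hβc μ hμ K hK L M hLβ hMβ n hn hnN ω a'
  obtain ⟨hrow, hcol₁, hrow₁⟩ := overlap_jump_sums_le_of_neighbouring (L := L) (M := M) hβ0 μ K hT0 hnb hJ hJN
  -- the constant: `T_J = (C_T + 729 C_T²/2)·M·L²`
  have eTJ : CT * M * (L : ℝ) ^ 2 + 729 * ((((2 * M : ℕ) : ℝ) ^ 1 * (L : ℝ) ^ 2)⁻¹ * (CT * M * (L : ℝ) ^ 2) ^ 2) =
      (CT + 729 * CT ^ 2 / 2) * M * (L : ℝ) ^ 2 := by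
    push_cast
    field_simp
  have e81 : ((27 : ℕ) : ℝ) * (3 * ((CT + 729 * CT ^ 2 / 2) * M * (L : ℝ) ^ 2) / (β * (L : ℝ) ^ 2)) =
      81 * (CT + 729 * CT ^ 2 / 2) * M / β := by
    push_cast
    field_simp
    ring
  have e3 : 3 * ((CT + 729 * CT ^ 2 / 2) * M * (L : ℝ) ^ 2) / (β * (L : ℝ) ^ 2) = 3 * (CT + 729 * CT ^ 2 / 2) * M / β := by
    field_simp
  refine ⟨fun X'' => ?_, fun ω'' ω' σ cc x' => ?_, fun ω'' ω' σ cc x'' => ?_⟩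
  · have h1 := hrow X''
    rw [eTJ, e81] at h1
    exact h1
  · have h1 := hcol₁ ω'' ω' σ cc x'
    rw [eTJ, e3] at h1
    exact h1
  · have h1 := hrow₁ ω'' ω' σ cc x''
    rw [eTJ, e3] at h1
    exact h1

/-- **The overlap constants at every jump under EXACTLY the binders of `stub_engine_step_norms`** (item stmt-HubbardSuperconductivity-20437:
`P.WF`, `R.WF2`, `0 < c ≤ klEngC₃6 P R`, `μ ∈ klWindowC`, `0 < U ≤ klEngU₀9 P R c`, `klBetaMin ≤ β ≤ e^{c/U²}`, `FrameOK R U (nScales β) μ K`,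
`klEngL₃ β U ≤ L`, `klEngM₃ β U L ≤ M`): `∃ C_J > 0` with, for all `k + 1 ≤ J′ ≤ nScales β + 1`, row sums `≤ 81·C_J·M/β` and per-pair position sums
(both orientations) `≤ 3·C_J·M/β` for `E(klAnisoFamily J′)·S(F̃_k)` — the package thresholds sit below the absolute ones
(`klEngC₃6 ≤ klEngC₃3 ≤` symbol threshold, `klEngU₀9 ≤ klEngU₀3 ≤` symbol threshold), `Gfr ≥ 0` by `R.WF2`, `β² ≤ L` / `β ≤ M` by
`sq_le_of_klEngL₃_le` / `le_of_klEngM₃_le`. [cite: BenfattoGiulianiMastropietro2006, §2.7 (2.71a), §2.8 (2.77)] -/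
theorem overlap_jump_sums_klEng :
    ∃ CJ : ℝ, 0 < CJ ∧ ∀ (P : SplitConsts) (R : RenConsts) (c : ℝ), P.WF → R.WF2 → 0 < c → c ≤ EngineV8.klEngC₃6 P R →
      ∀ μ ∈ klWindowC, ∀ U : ℝ, 0 < U → U ≤ EngineV8.klEngU₀9 P R c → ∀ β : ℝ, klBetaMin ≤ β → β ≤ Real.exp (c / U ^ 2) →
      ∀ K : TrigPolyC4v, FrameOK R U (nScales β) μ K → ∀ (L M : ℕ) [NeZero L] [NeZero M],
      EngineV8.klEngL₃ β U ≤ L → EngineV8.klEngM₃ β U L ≤ M → ∀ k J' : ℕ, k + 1 ≤ J' → J' ≤ nScales β + 1 →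
        (∀ X'' : SpaceTimeIdx L M × SectorLeg (sectorCount J'),
          ∑ X', ‖(sectorAnalysisMatrix L M β (klAnisoFamily L M β μ K klE0 J') *
            sectorSubMatrix L M β (bgmFatMultiplier L M klE0 β (nambuXiCT L μ K) k)) X'' X'‖ ≤ 81 * CJ * M / β) ∧
        (∀ (ω'' : Fin (sectorCount J')) (ω' : Fin (sectorCount k)) (σ c : Fin 2) (x' : SpaceTimeIdx L M),
          ∑ x'' : SpaceTimeIdx L M, ‖(sectorAnalysisMatrix L M β (klAnisoFamily L M β μ K klE0 J') *
            sectorSubMatrix L M β (bgmFatMultiplier L M klE0 β (nambuXiCT L μ K) k)) (x'', ((ω'', σ), c)) (x', ((ω', σ), c))‖ ≤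
            3 * CJ * M / β) ∧
        (∀ (ω'' : Fin (sectorCount J')) (ω' : Fin (sectorCount k)) (σ c : Fin 2) (x'' : SpaceTimeIdx L M),
          ∑ x' : SpaceTimeIdx L M, ‖(sectorAnalysisMatrix L M β (klAnisoFamily L M β μ K klE0 J') *
            sectorSubMatrix L M β (bgmFatMultiplier L M klE0 β (nambuXiCT L μ K) k)) (x'', ((ω'', σ), c)) (x', ((ω', σ), c))‖ ≤
            3 * CJ * M / β) := by
  have ha : (-4 : ℝ) < -(6 / 5) := by norm_num
  have hab : (-(6 / 5) : ℝ) ≤ -(1 / 10) := by norm_num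
  have hb : (-(1 / 10) : ℝ) < 0 := by norm_num
  obtain ⟨CJ, hCJ, h⟩ := overlap_jump_sums_of_thresholds ha hab hb
  refine ⟨CJ, hCJ, ?_⟩
  intro P R c _ hR2 hc hc6 μ hμ U hU hU9 β hβmin hβc K hK L M _ _ hL3 hM3 k J' hJ hJN
  have hRj : ∀ j, 0 ≤ R.Gfr j := EngineV8.gfr_nonneg_of_wf2 hR2
  exact h R hRj c U hc
    (hc6.trans ((EngineV8.klEngC₃6_le_klEngC₃3 P R).trans (EngineV8.klEngC₃3_le_symbolC₃ ha hab hb P hRj))) hU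
    (hU9.trans ((EngineV8.klEngU₀9_le_klEngU₀3 P R c).trans (EngineV8.klEngU₀3_le_symbolU₀ ha hab hb P hRj c)))
    β hβmin hβc μ hμ K hK L M (EngineV8.sq_le_of_klEngL₃_le hL3) (EngineV8.le_of_klEngM₃_le hβmin hL3 hM3) k J' hJ hJN

end Summit.HubbardSuperconductivity.HubbardSuperconductivity.Theorems.TorusFourierL2

end
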